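import Summits.QuantumFields.YangMills.Theorems.AllWindowsColdBoxBoxHighLineOrbitJacobianAssembly

/-!
# T-S5.4J∞ assembly core, LOWER BOUND with the SUP ball: `(2π²)^{−n'}·√(π/β)^N·(1 − 2N·e^{−βρ²}) ≤ N_J(V)` when the orbit map reaches the
# sup ball `max_j |c_j| ≤ ρ` from the inner box (the shape of ✓J4∞ `OrbitMapSup.orbitMap_bulkSurj_sup`)

Width seat `ym-line-sfw-p2-w2` (prover-ym-line-sfw-p2-w2-g32-0); recorded lift **L1** of the next rung U5 (`Cruxes/BoxWindowHighSU2213/U5-BLOCKERS.md` B1,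
planner ym-idea-2 g18), source (β) of the honest window count (bus ym-idea-1 2026-08-29T22:01Z): the lower bound ✓`OrbitJacobian.orbitNormaliser_lower_J`
feeds the Gaussian mass of an ℓ²-BALL `|c|₂ ≤ ρ`, whose deficit `e^{−βρ²/2}·√(2π/β)^N = e^{−βρ²/2}(√2)^N·√(π/β)^N` is small only for `βρ² ≳ N ≍ H⁴`
— in any norm this forces `ρ ≍ H²β^{-1/2}` and the `12θ < 1` window.  With the SUP ball the deficit is the per-coordinate union bound
`2N·e^{−βρ²}·√(π/β)^N` (fcl-p3's ✓`LaplaceSandwich.setIntegral_exists_coord_tail_le` at `P = 2β·1`), small as soon as `βρ² ≳ log N + p·log β`: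

* `OrbitJacobian.setIntegral_exp_neg_mul_dotProduct_self_coord_tail_le` — `∫_{∃ i, ρ ≤ |vᵢ|} e^{−β|v|²} ≤ 2·|ι|·e^{−βρ²}·√(π/β)^{|ι|}`;
* `OrbitJacobian.setIntegral_exp_neg_mul_dotProduct_self_supBall_ge` — `√(π/β)^{|ι|} − 2|ι|·e^{−βρ²}·√(π/β)^{|ι|} ≤ ∫_{∀ i, |vᵢ| ≤ ρ} e^{−β|v|²}`;
* ★★ **`OrbitJacobian.orbitNormaliser_lower_J_sup`** — ✓`orbitNormaliser_lower_J` VERBATIM with the surjectivity hypothesis in the SUP-ball shape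
  `∀ c, (∀ j, |c j| ≤ ρ) → ∃ v (‖(♭⁻¹v)_x‖ ≤ a₁), Ψ_V(v) = c` (exactly the conclusion of ✓J4∞) and the conclusion
  `(2π²)^{−n'}·(√(π/β)^N − 2N·e^{−βρ²}·√(π/β)^N) ≤ N_J(V)`.

The upper bound ✓`orbitNormaliser_upper_J` is reused verbatim by the window arithmetic (`…OrbitJacobianFinalSup`, with ✓J5a′ feeding `c₅ := c·H⁴/(1+log H)⁴`).
Everything proved; no definitions; Mathlib + tree only; standard axioms.  HONEST LABEL: a glue brick (U5 prep, helper) for the recorded lift L1 of the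
NEXT rung U5 (LINE-20 ⟨stmt-QuantumFields-24336⟩, UNSTAFFED, I23 open); S5 is untouched; U5, ⟨24336⟩, ⟨24004⟩ remain OPEN; no stub is closed by name;
no crux, rung or summit is proved; **the Yang–Mills mass gap is NOT proved by this file; no summit is proved by a line.**
-/

set_option autoImplicit false

noncomputable section

open MeasureTheory Matrix Real Metric Set
open Literature.MathematicalPhysics.QuantumFieldTheory.AxialGauge (boxEdges)
open Literature.MathematicalPhysics.QuantumLattice (gaugeTransformZd LGConfig ZdEdge)
open Literature.Probability.LatticeModels (Site)

namespace Summit.QuantumFields.YangMills.Theorems.AllWindowsColdBoxBoxHighLine.OrbitJacobian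

open LaplaceSandwich

/-! ## §1 The Gaussian mass of a sup ball -/

section Gauss

variable {ι : Type*} [Fintype ι] [DecidableEq ι]

/-- **Per-coordinate union-bound tail of `e^{−β|v|²}`**: `∫_{∃ i, ρ ≤ |vᵢ|} e^{−β|v|²} ≤ 2·|ι|·e^{−βρ²}·√(π/β)^{|ι|}` (`β > 0`, `ρ ≥ 0`;
✓`LaplaceSandwich.setIntegral_exists_coord_tail_le` at `P = (2β)·1`, whose coordinate variances are `(P⁻¹)ᵢᵢ = (2β)⁻¹`). [folklore] -/
theorem setIntegral_exp_neg_mul_dotProduct_self_coord_tail_le {β : ℝ} (hβ : 0 < β) {ρ : ℝ} (hρ : 0 ≤ ρ) :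
    ∫ v in {v : ι → ℝ | ∃ i, ρ ≤ |v i|}, Real.exp (-(β * (v ⬝ᵥ v))) ≤
      2 * Fintype.card ι * Real.exp (-(β * ρ ^ 2)) * Real.sqrt (Real.pi / β) ^ Fintype.card ι := by
  have hP := posDef_smul_one (ι := ι) hβ
  have h := setIntegral_exists_coord_tail_le hP hρ
  simp_rw [neg_half_quadForm_smul_one] at h
  have h2β : (2 * β) ≠ 0 := by positivity
  have hinv : ((2 * β) • (1 : Matrix ι ι ℝ))⁻¹ = (2 * β)⁻¹ • (1 : Matrix ι ι ℝ) := by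
    rw [inv_smul_of_posDef Matrix.PosDef.one h2β, inv_one]
  have hdiag : ∀ i, ((2 * β) • (1 : Matrix ι ι ℝ))⁻¹ i i = (2 * β)⁻¹ := fun i => by
    rw [hinv, Matrix.smul_apply, Matrix.one_apply_eq, smul_eq_mul, mul_one]
  have hexp : ∀ i, Real.exp (-(ρ ^ 2 / (2 * ((2 * β) • (1 : Matrix ι ι ℝ))⁻¹ i i))) = Real.exp (-(β * ρ ^ 2)) := fun i => by
    rw [hdiag]
    congr 1
    field_simp
  have hmass : Real.sqrt (2 * Real.pi) ^ Fintype.card ι / Real.sqrt ((2 * β) • (1 : Matrix ι ι ℝ)).det =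
      Real.sqrt (Real.pi / β) ^ Fintype.card ι := by
    rw [mass_smul (1 : Matrix ι ι ℝ) (by positivity : (0 : ℝ) < 2 * β), Matrix.det_one, Real.sqrt_one, div_one, ← div_pow]
    congr 1
    rw [div_eq_iff (Real.sqrt_pos.2 (by positivity : (0 : ℝ) < 2 * β)).ne', ← Real.sqrt_mul (div_pos Real.pi_pos hβ).le]
    congr 1
    field_simp
  rw [hmass] at h
  simp_rw [hexp] at h
  rw [Finset.sum_const, Finset.card_univ, nsmul_eq_mul] at h
  calc _ ≤ 2 * (Fintype.card ι * Real.exp (-(β * ρ ^ 2))) * Real.sqrt (Real.pi / β) ^ Fintype.card ι := h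
    _ = 2 * Fintype.card ι * Real.exp (-(β * ρ ^ 2)) * Real.sqrt (Real.pi / β) ^ Fintype.card ι := by ring

/-- **Gaussian mass of a centred SUP ball from below**: `√(π/β)^{|ι|} − 2|ι|·e^{−βρ²}·√(π/β)^{|ι|} ≤ ∫_{∀ i, |vᵢ| ≤ ρ} e^{−β|v|²}`. [folklore] -/
theorem setIntegral_exp_neg_mul_dotProduct_self_supBall_ge {β : ℝ} (hβ : 0 < β) {ρ : ℝ} (hρ : 0 ≤ ρ) :
    Real.sqrt (Real.pi / β) ^ Fintype.card ι - 2 * Fintype.card ι * Real.exp (-(β * ρ ^ 2)) * Real.sqrt (Real.pi / β) ^ Fintype.card ι ≤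
      ∫ v in {v : ι → ℝ | ∀ i, |v i| ≤ ρ}, Real.exp (-(β * (v ⬝ᵥ v))) := by
  have hfi := integrable_exp_neg_mul_dotProduct_self (ι := ι) hβ
  have hBm : MeasurableSet {v : ι → ℝ | ∀ i, |v i| ≤ ρ} := by
    have hset : {v : ι → ℝ | ∀ i, |v i| ≤ ρ} = ⋂ i, {v | |v i| ≤ ρ} := by ext v; simp
    rw [hset]
    exact MeasurableSet.iInter fun i => measurableSet_le (continuous_abs.comp (continuous_apply i)).measurable measurable_const
  have hcompl : {v : ι → ℝ | ∀ i, |v i| ≤ ρ}ᶜ ⊆ {v : ι → ℝ | ∃ i, ρ ≤ |v i|} := by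
    intro v hv
    simp only [Set.mem_compl_iff, Set.mem_setOf_eq, not_forall, not_le] at hv
    obtain ⟨i, hi⟩ := hv
    exact ⟨i, hi.le⟩
  have hsplit := integral_add_compl hBm hfi
  rw [integral_exp_neg_mul_dotProduct_self hβ] at hsplit
  have htail := setIntegral_exp_neg_mul_dotProduct_self_coord_tail_le (ι := ι) hβ hρ
  have hmono : ∫ v in {v : ι → ℝ | ∀ i, |v i| ≤ ρ}ᶜ, Real.exp (-(β * (v ⬝ᵥ v))) ≤
      ∫ v in {v : ι → ℝ | ∃ i, ρ ≤ |v i|}, Real.exp (-(β * (v ⬝ᵥ v))) :=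
    setIntegral_mono_set hfi.integrableOn (ae_of_all _ fun v => (Real.exp_pos _).le) (ae_of_all _ hcompl)
  linarith

end Gauss

/-! ## §2 The lower bound with the sup ball -/

variable (H : ℕ)

/-- ★★ **LOWER BOUND, sup-ball form.**  Hypotheses: J1; `F_V` invertible; the J2-contraction (constant `½`) on `S₀ = {∀x, ‖A_x‖ ≤ a₀}`, `a₀ < π`;
an inner radius `a₁ ≤ a₀` on whose box the cut-off is identically `1` (4p shape) and from which the orbit map reaches every `c` of the SUP ball
`max_j |c_j| ≤ ρ` (J4∞ shape), `ρ ≥ 0`, `β > 0`.  Then `(2π²)^{−n'}·(√(π/β)^N − 2N·e^{−βρ²}·√(π/β)^N) ≤ N_J(V)`, `N = |interiorSites H × Fin 3|`.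
[folklore] -/
theorem orbitNormaliser_lower_J_sup (hJ1 : OrbitMapJacobianDet) {β r a₀ a₁ ρ D : ℝ} (hβ : 0 < β) (ha₀π : a₀ < Real.pi) (ha₁ : a₁ ≤ a₀) (hρ : 0 ≤ ρ)
    (V : LGConfig 4 SU2) (hF : IsUnit (fpOperator H V).det)
    (hcontr : ∀ v : ↥(interiorSites H) × Fin 3 → ℝ, (∀ x, ‖(flatten ↥(interiorSites H)).symm v x‖ ≤ a₀) →
      ∀ w : ↥(interiorSites H) × Fin 3 → ℝ,
        (w - (fpOperator H V)⁻¹ *ᵥ (fderiv ℝ (orbitMapFlat H V) v w)) ⬝ᵥ (w - (fpOperator H V)⁻¹ *ᵥ (fderiv ℝ (orbitMapFlat H V) v w)) ≤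
          ((1/2 : NNReal) : ℝ) ^ 2 * (w ⬝ᵥ w))
    (hcut : ∀ A : ↥(interiorSites H) → EuclideanSpace ℝ (Fin 3), (∀ x, ‖A x‖ ≤ a₁) →
      ballCutoff H r (gaugeTransformZd (pauliGauge H A) V) = 1)
    (hsurj : ∀ c : ↥(interiorSites H) × Fin 3 → ℝ, (∀ j, |c j| ≤ ρ) →
      ∃ v : ↥(interiorSites H) × Fin 3 → ℝ, (∀ x, ‖vecToField H v x‖ ≤ a₁) ∧ orbitMapFlat H V v = c)
    (hdet : ∀ W : LGConfig 4 SU2, |(fpOperator H W).det| ≤ D) :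
    ((2 * Real.pi ^ 2) ^ (interiorSites H).card)⁻¹ *
        (Real.sqrt (Real.pi / β) ^ Fintype.card (↥(interiorSites H) × Fin 3) -
          2 * Fintype.card (↥(interiorSites H) × Fin 3) * Real.exp (-(β * ρ ^ 2)) *
            Real.sqrt (Real.pi / β) ^ Fintype.card (↥(interiorSites H) × Fin 3)) ≤
      orbitAverage H (jacWeight β H r) V := by
  set ι := ↥(interiorSites H) × Fin 3 with hι
  set K : ℝ := ((2 * Real.pi ^ 2) ^ (interiorSites H).card)⁻¹ with hK_def
  have hK : 0 ≤ K := by positivity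
  set f := orbitMapFlat H V with hf_def
  set Ψ : (ι → ℝ) → ℝ := fun v => pauliDensity ↥(interiorSites H) ((flatten ↥(interiorSites H)).symm v) *
    jacWeight β H r (gaugeTransformZd (pauliGauge H ((flatten ↥(interiorSites H)).symm v)) V) with hΨ_def
  have hΨ0 : ∀ v, 0 ≤ Ψ v := fun v => mul_nonneg (pauliDensity_nonneg_le _ _).1 (jacWeight_nonneg β H r _)
  have hΨi : Integrable Ψ := integrable_integrand H hβ.le r V hdet
  set S₀ : Set (ι → ℝ) := {v | ∀ x, ‖(flatten ↥(interiorSites H)).symm v x‖ ≤ a₀} with hS₀_def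
  set S₁ : Set (ι → ℝ) := {v | ∀ x, ‖(flatten ↥(interiorSites H)).symm v x‖ ≤ a₁} with hS₁_def
  obtain ⟨hS₀c, hS₀m⟩ := box_convex_measurable H a₀
  obtain ⟨_, hS₁m⟩ := box_convex_measurable H a₁
  have hS₁₀ : S₁ ⊆ S₀ := fun v hv x => (hv x).trans ha₁
  have hdiff₀ : ∀ v ∈ S₀, HasFDerivWithinAt f (fderiv ℝ f v) S₀ v := fun v _ => (hJ1 H V v).1.hasFDerivAt.hasFDerivWithinAt
  have hinj₀ : InjOn f S₀ := injOn_of_contraction hS₀c hdiff₀ hF (K := 1/2) (by norm_num) hcontr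
  have hdiff₁ : ∀ v ∈ S₁, HasFDerivWithinAt f (fderiv ℝ f v) S₁ v := fun v _ => (hJ1 H V v).1.hasFDerivAt.hasFDerivWithinAt
  have hinj₁ : InjOn f S₁ := hinj₀.mono hS₁₀
  set g : (ι → ℝ) → ℝ := fun c => Real.exp (-(β * (c ⬝ᵥ c))) with hg_def
  have hgi : Integrable g := integrable_exp_neg_mul_dotProduct_self hβ
  have hchange : ∫ c in f '' S₁, g c = ∫ v in S₁, |(fderiv ℝ f v).det| * g (f v) := setIntegral_image_eq hS₁m hdiff₁ hinj₁ g
  -- on `S₁` the integrand IS `K·|det Df|·g∘f`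
  have hbulk : ∀ v ∈ S₁, K * (|(fderiv ℝ f v).det| * g (f v)) = Ψ v := by
    intro v hv
    have hvπ : ∀ x, ‖(flatten ↥(interiorSites H)).symm v x‖ < Real.pi := fun x => lt_of_le_of_lt ((hv x).trans ha₁) ha₀π
    have hid := integrand_eq_of_lt_pi H hJ1 β r V v hvπ
    rw [hΨ_def]; dsimp only; rw [hid, hcut _ hv]; ring
  -- the SUP ball is inside the image
  have hball : {c : ι → ℝ | ∀ j, |c j| ≤ ρ} ⊆ f '' S₁ := by
    intro c hc
    obtain ⟨v, hv, hfv⟩ := hsurj c hc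
    exact ⟨v, fun x => by rw [← vecToField_eq_flatten_symm]; exact hv x, hfv⟩
  rw [orbitAverage_jacWeight_eq_flat]
  calc K * (Real.sqrt (Real.pi / β) ^ Fintype.card ι -
        2 * Fintype.card ι * Real.exp (-(β * ρ ^ 2)) * Real.sqrt (Real.pi / β) ^ Fintype.card ι)
      ≤ K * ∫ c in {c : ι → ℝ | ∀ j, |c j| ≤ ρ}, g c :=
        mul_le_mul_of_nonneg_left (setIntegral_exp_neg_mul_dotProduct_self_supBall_ge hβ hρ) hK
    _ ≤ K * ∫ c in f '' S₁, g c := mul_le_mul_of_nonneg_left (setIntegral_exp_neg_mul_dotProduct_self_mono hβ hball).1 hK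
    _ = ∫ v in S₁, K * (|(fderiv ℝ f v).det| * g (f v)) := by rw [hchange, integral_const_mul]
    _ = ∫ v in S₁, Ψ v := setIntegral_congr_fun hS₁m hbulk
    _ ≤ ∫ v, Ψ v := setIntegral_le_integral hΨi (ae_of_all _ hΨ0)

end Summit.QuantumFields.YangMills.Theorems.AllWindowsColdBoxBoxHighLine.OrbitJacobian

end
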